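import Literature.AlgebraicGeometry.ComplexMultiplication.CyclotomicCMTypeCensusFifteen
import Literature.AlgebraicGeometry.ComplexMultiplication.CyclotomicCMTypeCensusSixteen
import Literature.AlgebraicGeometry.ComplexMultiplication.CyclotomicCMTypeCensusTwenty
import Literature.AlgebraicGeometry.ComplexMultiplication.CyclotomicCMTypeCensusTwentyFour
import Literature.NumberTheory.NumberFields.CyclotomicFieldsDegreeLeEightClassNumber
import HarnessLib

/-!
# The CM types of a cyclotomic field of degree `8`, uniformly: `16` types, `8` primitive and `8` imprimitive, the primitive ones ONE
# `Aut`-family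

Layer `Literature/AlgebraicGeometry/ComplexMultiplication`, namespace `Literature.AlgebraicGeometry.ComplexMultiplication.CyclotomicCMTypeCensusDegreeEight`;
lane `lit-hodgefound` (Track 2 foundations library), prover seat `lit-hodgefound-p10`, generation 33, row «A3-(census φ = 8)» (self-proposed
2026-08-28).  Theorems only; no `def`, no instance, no named fact (net Literature debt 0).

The four cyclotomic fields of degree `8` — `ℚ(ζ₁₅) = ℚ(ζ₃₀)`, `ℚ(ζ₁₆)`, `ℚ(ζ₂₀)`, `ℚ(ζ₂₄)` (`φ(d) = 8 ⟺ d ∈ {15, 16, 20, 24, 30}`, this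
generation's `eq_of_two_lt_of_totient_le_eight`; `ℚ(ζ_{2m}) = ℚ(ζ_m)`, the tree's `isCyclotomicExtension_of_two_mul_of_odd`) — have, by this
generation's four censuses (`CyclotomicCMTypeCensusFifteen/Sixteen/Twenty/TwentyFour`, kernel counts over the CM residue sets), the SAME
coarse statistics, stated here once, uniformly in `d`:

* `eq_of_totient_eq_eight'` (`φ(d) = 8 ⟹ d ∈ {15, 16, 20, 24, 30}`, from the `φ(d) ≤ 8` list);
* **`natCard_cmType_of_totient_eq_eight`**: `#(CM types of ℚ(ζ_d)) = 16 = 2⁴`;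
* **`ncard_isPrimitive_and_not_of_totient_eq_eight`**: `8` primitive and `8` imprimitive types (normalised at an embedding `φ₀`: `4` and `4`,
  `ncard_normalised_isPrimitive_and_not_of_totient_eq_eight`);
* **`ncard_families_of_totient_eq_eight`**: the primitive types through `φ₀` form exactly ONE family under `Aut(ℚ(ζ_d))` — ONE simple
  CM abelian fourfold with complex multiplication by `ℚ(ζ_d)` up to isogeny (Shimura §8.4 Example (1): `(ℤ/d)ˣ` acts simply transitively
  on the residue sets with trivial stabiliser).
The finer statistics differ (`ℚ(ζ₂₄)`: four imprimitive kinds all with `|W| = 4`; the other three: one `B²`-kind and two `E⁴`-kinds) and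
stay in the per-field files.

## References

* [Shimura1998] G. Shimura, *Abelian Varieties with Complex Multiplication and Modular Functions* (1998), §8.2 Prop. 26, §8.4
  Examples (1)–(2).
* [KoblitzRohrlich1978] N. Koblitz, D. Rohrlich, *Simple factors in the Jacobian of a Fermat curve*, Canad. J. Math. 30 (1978), §1 p. 1184.
* [Washington1997] L. C. Washington, *Introduction to Cyclotomic Fields*, 2nd ed. (1997), Ch. 2.
-/

noncomputable section

open scoped Classical NumberField
open NumberField

namespace Literature.AlgebraicGeometry.ComplexMultiplication

namespace CyclotomicCMTypeCensusDegreeEight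

-- `open scoped`: the tree's action of `Aut(ℂ)` on `Hom(K, ℂ)` by composition (`ringEquivCompAction`) is a scoped instance
open scoped Literature.NumberTheory.ComplexMultiplication
open Literature.AlgebraicGeometry.Motives (CMType)
open Literature.NumberTheory.ComplexMultiplication (IsPrimitive)
open CyclotomicCMTypeResidueSets (IsAutTransform)
open CyclotomicCMTypeCensusFifteen (natCard_cmType_fifteen ncard_isPrimitive_and_not_fifteen ncard_normalised_isPrimitive_and_not_fifteen
  ncard_families_fifteen)
open CyclotomicCMTypeCensusSixteen (natCard_cmType_sixteen ncard_isPrimitive_and_not_sixteen ncard_normalised_isPrimitive_and_not_sixteen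
  ncard_families_sixteen)
open CyclotomicCMTypeCensusTwenty (natCard_cmType_twenty ncard_isPrimitive_and_not_twenty ncard_normalised_isPrimitive_and_not_twenty
  ncard_families_twenty)
open CyclotomicCMTypeCensusTwentyFour (natCard_cmType_twentyFour ncard_isPrimitive_and_not_twentyFour
  ncard_normalised_isPrimitive_and_not_twentyFour ncard_families_twentyFour)
open Literature.NumberTheory.NumberFields (eq_of_two_lt_of_totient_le_eight)
open Literature.NumberTheory.Automorphic.Arthur2013.Leaves.TECR.TorusDict (isCyclotomicExtension_of_two_mul_of_odd)

variable {d : ℕ} {L : Type} [Field L] [NumberField L]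

/-- `φ(d) = 8 ⟹ d ∈ {15, 16, 20, 24, 30}` (from this generation's list of the `d > 2` with `φ(d) ≤ 8`). [cite: Washington1997, Ch. 2] [folklore] -/
theorem eq_of_totient_eq_eight' (h8 : Nat.totient d = 8) : d = 15 ∨ d = 16 ∨ d = 20 ∨ d = 24 ∨ d = 30 := by
  have hd : 2 < d := by
    by_contra hle
    interval_cases d <;> simp_all
  rcases eq_of_two_lt_of_totient_le_eight hd h8.le with
    rfl | rfl | rfl | rfl | rfl | rfl | rfl | rfl | rfl | rfl | rfl | rfl | rfl | rfl | rfl | rfl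
  all_goals first | decide | exact absurd h8 (by decide)

/-- `ℚ(ζ₃₀) = ℚ(ζ₁₅)`. [cite: Washington1997, Ch. 2] [folklore] -/
private theorem isCyclotomicExtension_fifteen_of_thirty₄₂ (hL : IsCyclotomicExtension {30} ℚ L) : IsCyclotomicExtension {15} ℚ L := by
  haveI : IsCyclotomicExtension {2 * 15} ℚ L := hL
  exact isCyclotomicExtension_of_two_mul_of_odd (K := L) (by decide)

/-- **EVERY CYCLOTOMIC FIELD OF DEGREE `8` HAS EXACTLY `16 = 2⁴` CM TYPES.** [cite: Shimura1998, §8.4 Example (1)] -/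
theorem natCard_cmType_of_totient_eq_eight (hL : IsCyclotomicExtension {d} ℚ L) (h8 : Nat.totient d = 8) : Nat.card (CMType L) = 16 := by
  rcases eq_of_totient_eq_eight' h8 with rfl | rfl | rfl | rfl | rfl
  · exact natCard_cmType_fifteen hL
  · haveI := hL; exact natCard_cmType_sixteen
  · exact natCard_cmType_twenty hL
  · exact natCard_cmType_twentyFour hL
  · exact natCard_cmType_fifteen (isCyclotomicExtension_fifteen_of_thirty₄₂ hL)

/-- **`8` PRIMITIVE AND `8` IMPRIMITIVE CM TYPES** for every cyclotomic field of degree `8`. [cite: Shimura1998, §8.2 Prop. 26, §8.4 Examples (1)–(2)]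
[cite: KoblitzRohrlich1978, §1 p. 1184] -/
theorem ncard_isPrimitive_and_not_of_totient_eq_eight (hL : IsCyclotomicExtension {d} ℚ L) (h8 : Nat.totient d = 8) (φ₀ : L →+* ℂ) :
    {Φ : CMType L | IsPrimitive (ℂ ≃+* ℂ) Φ.1 φ₀}.ncard = 8 ∧ {Φ : CMType L | ¬IsPrimitive (ℂ ≃+* ℂ) Φ.1 φ₀}.ncard = 8 := by
  rcases eq_of_totient_eq_eight' h8 with rfl | rfl | rfl | rfl | rfl
  · exact ncard_isPrimitive_and_not_fifteen hL φ₀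
  · haveI := hL; exact ncard_isPrimitive_and_not_sixteen φ₀
  · exact ncard_isPrimitive_and_not_twenty hL φ₀
  · exact ncard_isPrimitive_and_not_twentyFour hL φ₀
  · exact ncard_isPrimitive_and_not_fifteen (isCyclotomicExtension_fifteen_of_thirty₄₂ hL) φ₀

/-- Normalised at an embedding `φ₀` (`φ₀ ∈ Φ`): `4` primitive and `4` imprimitive types. [cite: Shimura1998, §8.4 Examples (1)–(2)] -/
theorem ncard_normalised_isPrimitive_and_not_of_totient_eq_eight (hL : IsCyclotomicExtension {d} ℚ L) (h8 : Nat.totient d = 8)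
    (φ₀ : L →+* ℂ) :
    {Φ : CMType L | φ₀ ∈ Φ.1 ∧ IsPrimitive (ℂ ≃+* ℂ) Φ.1 φ₀}.ncard = 4 ∧
      {Φ : CMType L | φ₀ ∈ Φ.1 ∧ ¬IsPrimitive (ℂ ≃+* ℂ) Φ.1 φ₀}.ncard = 4 := by
  rcases eq_of_totient_eq_eight' h8 with rfl | rfl | rfl | rfl | rfl
  · exact ncard_normalised_isPrimitive_and_not_fifteen hL φ₀
  · haveI := hL; exact ncard_normalised_isPrimitive_and_not_sixteen φ₀
  · exact ncard_normalised_isPrimitive_and_not_twenty hL φ₀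
  · exact ncard_normalised_isPrimitive_and_not_twentyFour hL φ₀
  · exact ncard_normalised_isPrimitive_and_not_fifteen (isCyclotomicExtension_fifteen_of_thirty₄₂ hL) φ₀

/-- **THE PRIMITIVE CM TYPES OF EVERY CYCLOTOMIC FIELD OF DEGREE `8` FORM ONE `Aut`-FAMILY** (normalised at `φ₀`: one family of the four
primitive types through `φ₀`) — one simple CM fourfold with complex multiplication by `ℚ(ζ_d)` up to isogeny.
[cite: Shimura1998, §8.4 Example (1)] [cite: KoblitzRohrlich1978, §1 p. 1184] -/
theorem ncard_families_of_totient_eq_eight (hL : IsCyclotomicExtension {d} ℚ L) (h8 : Nat.totient d = 8) (φ₀ : L →+* ℂ) :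
    {F : Set (CMType L) | ∃ Φ : CMType L, φ₀ ∈ Φ.1 ∧ IsPrimitive (ℂ ≃+* ℂ) Φ.1 φ₀ ∧
        F = {Ψ | φ₀ ∈ Ψ.1 ∧ IsAutTransform Φ Ψ}}.ncard = 1 ∧
      {Φ : CMType L | φ₀ ∈ Φ.1 ∧ IsPrimitive (ℂ ≃+* ℂ) Φ.1 φ₀}.ncard = 4 := by
  rcases eq_of_totient_eq_eight' h8 with rfl | rfl | rfl | rfl | rfl
  · exact ncard_families_fifteen hL φ₀
  · haveI := hL; exact ncard_families_sixteen φ₀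
  · exact ncard_families_twenty hL φ₀
  · exact ncard_families_twentyFour hL φ₀
  · exact ncard_families_fifteen (isCyclotomicExtension_fifteen_of_thirty₄₂ hL) φ₀

end CyclotomicCMTypeCensusDegreeEight

end Literature.AlgebraicGeometry.ComplexMultiplication

end
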